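import Mathlib
import HarnessLib
import Literature.MathematicalPhysics.QuantumLattice.GaugeGroupsProofs

/-!
# The `SU(3)` plaquette range: `−3/2 ≤ Re tr U ≤ 3` on `SU(3)`, the lower end attained exactly at the two non-trivial centre elements; the `SU(3)` Wilson action density lies in `[0, 9/2]`

HONEST FRAMING: exact (Metropolis-corrected) sampling algorithms for lattice gauge theory;
figures of merit are autocorrelation/cost numbers at stated couplings and volumes; no
continuum-physics claim.

Venture `LatticeQCDFlow` (cell pub-lqcd), sub-topic `Scoring`; FANOUT row 21 (`su3-base`: the 4D
`SU(3)` baselines E1 = 1HB+4OR, E2 = PBC-HMC, OBC-HMC; the boarded plaquette observable is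
`P = (1/3) Re tr U_p`, CARD-su3-base.md §3, acceptance (a)).  NEW WORK of the cell (placement rule),
elementary, over the Literature file `QuantumLattice/GaugeGroupsProofs` (`reTr`, `reTr_le`:
`Re tr ≤ n` on `SU(n)`, `eq_one_of_reTr_eq`: `= n` only at `1`, `exists_conj_eq_diagonal`: the torus
theorem of Bröcker–tom Dieck IV (3.1)); no definition is introduced; nothing is cited as a fact; no
number of ours.

The generic unitary bound `|Re tr U| ≤ N` gives the `SU(3)` plaquette the window `[−1, 1]` and the
Wilson density `3 − Re tr U_p` the window `[0, 6]`.  For `SU(3)` the lower end is NOT attained: the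
eigenvalues `λ₁, λ₂, λ₃` are unimodular with `λ₁λ₂λ₃ = 1`, and

  `3 + 2 Re tr U = |1 + λ₁ + conj λ₂|² ≥ 0`,

so `Re tr U ≥ −3/2`, with equality iff `λ₁ = λ₂ = λ₃ = ζ`, `ζ³ = 1`, `ζ ≠ 1`, i.e. iff `U` is one of
the two non-trivial centre elements `e^{±2πi/3}·1`.  (The maximum `3` is attained only at the trivial
centre element `1` — the tree's `eq_one_of_reTr_eq`.)

## What is proved

* §1 (three unimodular numbers with product one) `normSq_one_add_add_conj_eq`
  (`|1 + a + b̄|² = 3 + 2(Re a + Re b + Re c)`), **`neg_three_halves_le_re_add`**,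
  **`re_add_eq_neg_three_halves_iff`** (`= −3/2 ⇔ a = b = c ≠ 1`), `re_eq_neg_half_of_pow_three_eq_one`
  (a non-trivial cube root of unity has real part `−1/2`).
* §2 (`SU(3)`) **`neg_three_halves_le_reTr`** (`−3/2 ≤ Re tr U`), **`reTr_eq_neg_three_halves_iff`**
  (`Re tr U = −3/2 ⇔ U = ζ·1` with `ζ³ = 1`, `ζ ≠ 1`), `reTr_eq_three_iff` (`= 3 ⇔ U = 1`),
  `exists_reTr_eq_neg_three_halves`, **`range_reTr_su3`**: the range of `Re tr` on `SU(3)` is EXACTLY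
  the interval `[−3/2, 3]` (`SU(3)` is connected — the tree's `connectedSpace_specialUnitaryGroup` —
  and `Re tr` is continuous).
* §3 (row 21's observables) `su3Plaquette_mem_Icc` (`(1/3) Re tr U ∈ [−1/2, 1]`),
  `su3WilsonDensity_mem_Icc` (`3 − Re tr U ∈ [0, 9/2]`), **`wilsonAction_su3_nonneg`**,
  **`wilsonAction_su3_le`** (`0 ≤ S(U) ≤ (9/2)·#plaquettes` for every `SU(3)` configuration on the
  torus, the Literature's `wilsonAction (fundamentalRep (Fin 3))`), and `exp_neg_wilsonAction_su3_ge`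
  (the Boltzmann factor `e^{−(β/3) S} ≥ e^{−(3/2) β #plaquettes}` for `β ≥ 0`).

NOT CLAIMED: anything about the DISTRIBUTION of the plaquette under the Wilson measure (the row's
numbers); the `SU(N)` analogue for other `N` (for even `N` the generic `−N` is attained at `−1`; for odd
`N ≥ 5` the minimum is different and not treated here).
-/

namespace Summit.Ventures.LatticeQCDFlow.Scoring

open Matrix Complex
open Literature.MathematicalPhysics.QuantumLattice
open Literature.MathematicalPhysics.QuantumFieldTheory

/-! ## §1 Three unimodular complex numbers with product one -/

/-- **The key identity**: for unimodular `a, b` and `c` with `a b c = 1`,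
`|1 + a + b̄|² = 3 + 2 (Re a + Re b + Re c)` (because `c = conj (a b)`, so `Re c = Re (a b)`). -/
theorem normSq_one_add_add_conj_eq {a b c : ℂ} (ha : ‖a‖ = 1) (hb : ‖b‖ = 1) (habc : a * b * c = 1) :
    ‖1 + a + (starRingEnd ℂ) b‖ ^ 2 = 3 + 2 * (a.re + b.re + c.re) := by
  have hab : ‖a * b‖ = 1 := by rw [norm_mul, ha, hb, mul_one]
  have hc : c = (starRingEnd ℂ) (a * b) := by
    rw [← inv_eq_conj_of_norm_eq_one hab]
    exact (inv_eq_of_mul_eq_one_right habc).symm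
  have ha2 : a.re * a.re + a.im * a.im = 1 := by
    have h := Complex.sq_norm a
    rw [ha, one_pow, Complex.normSq_apply] at h
    exact h.symm
  have hb2 : b.re * b.re + b.im * b.im = 1 := by
    have h := Complex.sq_norm b
    rw [hb, one_pow, Complex.normSq_apply] at h
    exact h.symm
  rw [Complex.sq_norm, Complex.normSq_apply, hc]
  simp only [Complex.add_re, Complex.add_im, Complex.one_re, Complex.one_im, Complex.conj_re,
    Complex.conj_im, Complex.mul_re]
  linear_combination ha2 + hb2

/-- **`Re a + Re b + Re c ≥ −3/2`** for unimodular `a, b` with `a b c = 1`. -/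
theorem neg_three_halves_le_re_add {a b c : ℂ} (ha : ‖a‖ = 1) (hb : ‖b‖ = 1) (habc : a * b * c = 1) :
    -(3 / 2 : ℝ) ≤ a.re + b.re + c.re := by
  have h := normSq_one_add_add_conj_eq ha hb habc
  have h0 : 0 ≤ ‖1 + a + (starRingEnd ℂ) b‖ ^ 2 := sq_nonneg _
  rw [h] at h0
  linarith

/-- A cube root of unity other than `1` has real part `−1/2` (it is a root of `ζ² + ζ + 1`). -/
theorem re_eq_neg_half_of_pow_three_eq_one {ζ : ℂ} (h : ζ ^ 3 = 1) (h1 : ζ ≠ 1) :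
    ζ.re = -(1 / 2 : ℝ) := by
  have h2 : ζ ^ 2 + ζ + 1 = 0 := by
    have hfac : (ζ - 1) * (ζ ^ 2 + ζ + 1) = 0 := by
      calc (ζ - 1) * (ζ ^ 2 + ζ + 1) = ζ ^ 3 - 1 := by ring
        _ = 0 := by rw [h, sub_self]
    exact (mul_eq_zero.mp hfac).resolve_left (sub_ne_zero.mpr h1)
  have hre : ζ.re * ζ.re - ζ.im * ζ.im + ζ.re + 1 = 0 := by
    have := congrArg Complex.re h2
    simpa [sq, Complex.mul_re] using this
  have him : ζ.im * (2 * ζ.re + 1) = 0 := by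
    have := congrArg Complex.im h2
    simp only [sq, Complex.add_im, Complex.mul_im, Complex.one_im, Complex.zero_im] at this
    linear_combination this
  rcases mul_eq_zero.mp him with hi | hr
  · exfalso
    rw [hi, mul_zero, sub_zero] at hre
    nlinarith [sq_nonneg (ζ.re + 1 / 2)]
  · linarith

/-- **The equality case**: for unimodular `a, b` with `a b c = 1`, `Re a + Re b + Re c = −3/2` iff
`a = b = c ≠ 1` (then `a³ = 1`, so the common value is a non-trivial cube root of unity). -/
theorem re_add_eq_neg_three_halves_iff {a b c : ℂ} (ha : ‖a‖ = 1) (hb : ‖b‖ = 1)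
    (habc : a * b * c = 1) :
    a.re + b.re + c.re = -(3 / 2 : ℝ) ↔ a = b ∧ b = c ∧ a ≠ 1 := by
  have hab : ‖a * b‖ = 1 := by rw [norm_mul, ha, hb, mul_one]
  have hc : c = (starRingEnd ℂ) (a * b) := by
    rw [← inv_eq_conj_of_norm_eq_one hab]
    exact (inv_eq_of_mul_eq_one_right habc).symm
  have ha2 : a.re * a.re + a.im * a.im = 1 := by
    have h := Complex.sq_norm a
    rw [ha, one_pow, Complex.normSq_apply] at h
    exact h.symm
  have hb2 : b.re * b.re + b.im * b.im = 1 := by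
    have h := Complex.sq_norm b
    rw [hb, one_pow, Complex.normSq_apply] at h
    exact h.symm
  constructor
  · intro h
    have hn : ‖1 + a + (starRingEnd ℂ) b‖ ^ 2 = 0 := by
      rw [normSq_one_add_add_conj_eq ha hb habc, h]; ring
    have hz : 1 + a + (starRingEnd ℂ) b = 0 := by
      rwa [sq_eq_zero_iff, norm_eq_zero] at hn
    have hzre : 1 + a.re + b.re = 0 := by
      have := congrArg Complex.re hz
      simpa using this
    have hzim : a.im + -b.im = 0 := by
      have := congrArg Complex.im hz
      simpa using this
    -- `Re a = −1/2`: substitute `Re b = −1 − Re a`, `Im b = Im a` into `|b| = 1`.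
    have har : a.re = -(1 / 2 : ℝ) := by
      have hbr : b.re = -1 - a.re := by linarith
      have hbi : b.im = a.im := by linarith
      rw [hbr, hbi] at hb2
      nlinarith [ha2, hb2]
    have hbr : b.re = -(1 / 2 : ℝ) := by linarith
    have hbi : b.im = a.im := by linarith
    have hab' : a = b := Complex.ext (by rw [har, hbr]) hbi.symm
    have hcr : c.re = -(1 / 2 : ℝ) := by linarith
    have hci : c.im = a.im := by
      rw [hc, ← hab']
      simp only [Complex.conj_im, Complex.mul_im]
      rw [har]; ring
    refine ⟨hab', hab' ▸ (Complex.ext (by rw [har, hcr]) hci.symm), ?_⟩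
    intro h1
    rw [h1, Complex.one_re] at har
    norm_num at har
  · rintro ⟨hab', hbc, h1⟩
    have h3 : a ^ 3 = 1 := by
      calc a ^ 3 = a * b * c := by rw [← hbc, ← hab']; ring
        _ = 1 := habc
    have har := re_eq_neg_half_of_pow_three_eq_one h3 h1
    rw [← hbc, ← hab', har]
    norm_num

/-! ## §2 `SU(3)`: the lower end of the range of `Re tr` -/

section SpecialUnitaryThree

/-- **`Re tr U ≥ −3/2` on `SU(3)`** (diagonalise: the eigenvalues are unimodular with product one). -/
theorem neg_three_halves_le_reTr (x : Matrix.specialUnitaryGroup (Fin 3) ℂ) :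
    -(3 / 2 : ℝ) ≤ reTr x := by
  obtain ⟨u, D, d, hD, rfl⟩ := exists_conj_eq_diagonal x
  rw [reTr_conj, reTr_eq_sum hD, Fin.sum_univ_three]
  have h1 := norm_eq_one_of_coe_eq_diagonal hD
  have hp := prod_eq_one_of_coe_eq_diagonal hD
  rw [Fin.prod_univ_three] at hp
  exact neg_three_halves_le_re_add (h1 0) (h1 1) hp

/-- The two-sided window: `−3/2 ≤ Re tr U ≤ 3` on `SU(3)` (upper end: the tree's `reTr_le`). -/
theorem reTr_su3_mem_Icc (x : Matrix.specialUnitaryGroup (Fin 3) ℂ) :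
    reTr x ∈ Set.Icc (-(3 / 2 : ℝ)) 3 := by
  refine ⟨neg_three_halves_le_reTr x, ?_⟩
  have h := reTr_le x
  simp only [Fintype.card_fin, Nat.cast_ofNat] at h
  exact h

/-- **The equality case**: `Re tr U = −3/2` on `SU(3)` iff `U = ζ·1` with `ζ³ = 1`, `ζ ≠ 1` — one of the
two non-trivial CENTRE elements `e^{±2πi/3}·1`. -/
theorem reTr_eq_neg_three_halves_iff (x : Matrix.specialUnitaryGroup (Fin 3) ℂ) :
    reTr x = -(3 / 2 : ℝ) ↔
      ∃ ζ : ℂ, ζ ^ 3 = 1 ∧ ζ ≠ 1 ∧ (x : Matrix (Fin 3) (Fin 3) ℂ) = ζ • (1 : Matrix (Fin 3) (Fin 3) ℂ) := by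
  constructor
  · intro h
    obtain ⟨u, D, d, hD, rfl⟩ := exists_conj_eq_diagonal x
    rw [reTr_conj, reTr_eq_sum hD, Fin.sum_univ_three] at h
    have h1 := norm_eq_one_of_coe_eq_diagonal hD
    have hp := prod_eq_one_of_coe_eq_diagonal hD
    rw [Fin.prod_univ_three] at hp
    obtain ⟨h01, h12, hne⟩ := (re_add_eq_neg_three_halves_iff (h1 0) (h1 1) hp).mp h
    refine ⟨d 0, ?_, hne, ?_⟩
    · calc d 0 ^ 3 = d 0 * d 1 * d 2 := by rw [← h12, ← h01]; ring
        _ = 1 := hp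
    · have hd : d = fun _ => d 0 := by
        funext i
        fin_cases i
        · rfl
        · exact h01.symm
        · exact (h01.trans h12).symm
      have hDm : (D : Matrix (Fin 3) (Fin 3) ℂ) = d 0 • (1 : Matrix (Fin 3) (Fin 3) ℂ) := by
        rw [hD, hd, smul_one_eq_diagonal]
      change (u : Matrix (Fin 3) (Fin 3) ℂ) * (D : Matrix (Fin 3) (Fin 3) ℂ) *
          star (u : Matrix (Fin 3) (Fin 3) ℂ) = _
      rw [hDm, Matrix.mul_smul, Matrix.mul_one, Matrix.smul_mul, Unitary.mul_star_self_of_mem u.2.1]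
  · rintro ⟨ζ, h3, h1, hx⟩
    change ((x : Matrix (Fin 3) (Fin 3) ℂ).trace).re = _
    rw [hx, Matrix.trace_smul, Matrix.trace_one, Fintype.card_fin, smul_eq_mul]
    have hre := re_eq_neg_half_of_pow_three_eq_one h3 h1
    simp only [Complex.mul_re, Complex.natCast_re, Complex.natCast_im, mul_zero, sub_zero, hre]
    norm_num

/-- The upper end for comparison (the tree's `reTr_le` / `eq_one_of_reTr_eq`, specialised):
`Re tr U = 3` on `SU(3)` iff `U = 1` — the trivial centre element. -/
theorem reTr_eq_three_iff (x : Matrix.specialUnitaryGroup (Fin 3) ℂ) : reTr x = 3 ↔ x = 1 := by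
  constructor
  · intro h
    exact eq_one_of_reTr_eq x (by rw [h]; simp)
  · rintro rfl
    rw [reTr_one]; simp

/-- The lower end IS attained: `Re tr (e^{2πi/3}·1) = −3/2`, and `e^{2πi/3}·1 ∈ SU(3)`. -/
theorem exists_reTr_eq_neg_three_halves :
    ∃ x : Matrix.specialUnitaryGroup (Fin 3) ℂ, reTr x = -(3 / 2 : ℝ) := by
  set ω : ℂ := Complex.exp (((2 * Real.pi / 3 : ℝ) : ℂ) * Complex.I) with hω
  have hn : ‖ω‖ = 1 := Complex.norm_exp_ofReal_mul_I _
  have h3 : ω ^ 3 = 1 := by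
    rw [hω, ← Complex.exp_nat_mul]
    have : ((3 : ℕ) : ℂ) * (((2 * Real.pi / 3 : ℝ) : ℂ) * Complex.I) = 2 * Real.pi * Complex.I := by
      push_cast; ring
    rw [this, Complex.exp_two_pi_mul_I]
  have h1 : ω ≠ 1 := by
    intro h
    have him : ω.im = Real.sin (2 * Real.pi / 3) := by rw [hω]; exact Complex.exp_ofReal_mul_I_im _
    have hpos : 0 < Real.sin (2 * Real.pi / 3) :=
      Real.sin_pos_of_pos_of_lt_pi (by positivity) (by linarith [Real.pi_pos])
    rw [h, Complex.one_im] at him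
    linarith
  have hmem : Matrix.diagonal (fun _ : Fin 3 => ω) ∈ Matrix.specialUnitaryGroup (Fin 3) ℂ := by
    rw [diagonal_mem_specialUnitaryGroup_iff]
    refine ⟨fun _ => hn, ?_⟩
    rw [Finset.prod_const, Finset.card_univ, Fintype.card_fin, h3]
  refine ⟨⟨_, hmem⟩, (reTr_eq_neg_three_halves_iff _).mpr ⟨ω, h3, h1, ?_⟩⟩
  exact (smul_one_eq_diagonal ω).symm

/-- **The range of `Re tr` on `SU(3)` is exactly `[−3/2, 3]`**: both ends are attained (at the centre)
and `SU(3)` is connected, so every intermediate value occurs. -/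
theorem range_reTr_su3 :
    Set.range (reTr : Matrix.specialUnitaryGroup (Fin 3) ℂ → ℝ) = Set.Icc (-(3 / 2 : ℝ)) 3 := by
  apply Set.Subset.antisymm
  · rintro _ ⟨x, rfl⟩
    exact reTr_su3_mem_Icc x
  · obtain ⟨x₀, hx₀⟩ := exists_reTr_eq_neg_three_halves
    haveI : ConnectedSpace (Matrix.specialUnitaryGroup (Fin 3) ℂ) := connectedSpace_specialUnitaryGroup
    have h := intermediate_value_univ x₀ (1 : Matrix.specialUnitaryGroup (Fin 3) ℂ)
      (continuous_reTr (n := Fin 3))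
    rw [hx₀, reTr_one, Fintype.card_fin] at h
    simpa using h

/-! ## §3 Row 21's observables: the plaquette, the Wilson density, the Wilson action -/

/-- **The `SU(3)` plaquette variable `(1/3) Re tr U` lies in `[−1/2, 1]`** (not `[−1, 1]`). -/
theorem su3Plaquette_mem_Icc (x : Matrix.specialUnitaryGroup (Fin 3) ℂ) :
    (1 / 3 : ℝ) * ((x : Matrix (Fin 3) (Fin 3) ℂ).trace).re ∈ Set.Icc (-(1 / 2 : ℝ)) 1 := by
  have h := reTr_su3_mem_Icc x
  change reTr x ∈ _ at h
  have h' : (1 / 3 : ℝ) * ((x : Matrix (Fin 3) (Fin 3) ℂ).trace).re = (1 / 3 : ℝ) * reTr x := rfl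
  rw [h']
  constructor <;> nlinarith [h.1, h.2]

/-- **The `SU(3)` Wilson action density `3 − Re tr U` lies in `[0, 9/2]`** (not `[0, 6]`). -/
theorem su3WilsonDensity_mem_Icc (x : Matrix.specialUnitaryGroup (Fin 3) ℂ) :
    (3 : ℝ) - ((x : Matrix (Fin 3) (Fin 3) ℂ).trace).re ∈ Set.Icc (0 : ℝ) (9 / 2) := by
  have h := reTr_su3_mem_Icc x
  change ((x : Matrix (Fin 3) (Fin 3) ℂ).trace).re ∈ _ at h
  constructor <;> linarith [h.1, h.2]

variable {d L : ℕ} [NeZero L]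

/-- **`S(U) ≥ 0`** for the `SU(3)` Wilson action of every configuration on the torus `(ℤ/L)^d`. -/
theorem wilsonAction_su3_nonneg (U : GaugeConfig d L (Matrix.specialUnitaryGroup (Fin 3) ℂ)) :
    0 ≤ wilsonAction (fundamentalRep (Fin 3)) U := by
  unfold wilsonAction
  refine Finset.sum_nonneg fun p _ => ?_
  rw [fundamentalRep_apply]
  have h := (su3WilsonDensity_mem_Icc (plaquetteHolonomy U p.1 p.2.1.1 p.2.1.2)).1
  simpa using h

/-- **`S(U) ≤ (9/2)·#plaquettes`** for the `SU(3)` Wilson action of every configuration on the torus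
(the generic unitary bound would give `6·#plaquettes`). -/
theorem wilsonAction_su3_le (U : GaugeConfig d L (Matrix.specialUnitaryGroup (Fin 3) ℂ)) :
    wilsonAction (fundamentalRep (Fin 3)) U ≤ (9 / 2 : ℝ) * Fintype.card (Plaquette d L) := by
  unfold wilsonAction
  have h : ∀ p ∈ (Finset.univ : Finset (Plaquette d L)),
      ((3 : ℕ) : ℝ) - ((fundamentalRep (Fin 3) (plaquetteHolonomy U p.1 p.2.1.1 p.2.1.2)).trace).re
        ≤ 9 / 2 := by
    intro p _
    rw [fundamentalRep_apply]
    have h := (su3WilsonDensity_mem_Icc (plaquetteHolonomy U p.1 p.2.1.1 p.2.1.2)).2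
    simpa using h
  calc ∑ p : Plaquette d L,
        (((3 : ℕ) : ℝ) - ((fundamentalRep (Fin 3) (plaquetteHolonomy U p.1 p.2.1.1 p.2.1.2)).trace).re)
      ≤ ∑ _p : Plaquette d L, (9 / 2 : ℝ) := Finset.sum_le_sum h
    _ = (9 / 2 : ℝ) * Fintype.card (Plaquette d L) := by
      rw [Finset.sum_const, Finset.card_univ, nsmul_eq_mul, mul_comm]

/-- **The Boltzmann factor floor**: in the engine's normalisation `e^{−(β/3) S(U)}`, for `β ≥ 0` every
`SU(3)` configuration has weight at least `e^{−(3/2) β #plaquettes}`. -/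
theorem exp_neg_wilsonAction_su3_ge {β : ℝ} (hβ : 0 ≤ β)
    (U : GaugeConfig d L (Matrix.specialUnitaryGroup (Fin 3) ℂ)) :
    Real.exp (-((3 / 2 : ℝ) * β * Fintype.card (Plaquette d L)))
      ≤ Real.exp (-(β / 3 * wilsonAction (fundamentalRep (Fin 3)) U)) := by
  rw [Real.exp_le_exp, neg_le_neg_iff]
  have h := wilsonAction_su3_le U
  calc β / 3 * wilsonAction (fundamentalRep (Fin 3)) U
      ≤ β / 3 * ((9 / 2 : ℝ) * Fintype.card (Plaquette d L)) :=
        mul_le_mul_of_nonneg_left h (by positivity)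
    _ = (3 / 2 : ℝ) * β * Fintype.card (Plaquette d L) := by ring

end SpecialUnitaryThree

end Summit.Ventures.LatticeQCDFlow.Scoring
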